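import Summits.HubbardSuperconductivity.HubbardLadder.Bounds.FdcEval2x2
import HarnessLib

/-!
# Hoisting identities for the integer evaluator of the circuit certificate `F31`

HONEST FRAMING: ladder R1–R4 with certified numbers; no claim on H/H₀; bounds for model classes,
no materials claim.

Pure finite (`ℤ`-valued) algebra relating the direct sums of `FdcEval2x2` — which mirror the
`ℂ`-valued closed forms of `FdcTwoTilingEnergy` term by term — to the sparse / hoisted forms the
kernel evaluates: `XIdir = XI`, `XBIdir = XBI`, `DIdir = DIdef` (only the configurations agreeing
off the acted-on sites contribute), the factorisation `P1I = SS · Dfac (xcode) (codeOf)` of the corner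
product, and the hoisting identity `IAdir = IAfast` (the quadruple sum over two plaquette
configuration pairs collapses to a double sum against a 16-entry twisted-weight table, given kernel
checks of the two 16-entry tables `W2def = W`, `Tdef W = T`). [folklore]
-/

namespace Summit.HubbardSuperconductivity.HubbardLadder.Bounds

open Finset

/-! ### Bit facts (finite checks) -/

/-- [folklore] -/
theorem fbit_fsetb_self : ∀ (m : Fin 4) (a : Fin 2) (j : Fin 16), fbit m (fsetb m a j) = a := by
  decide +kernel

/-- [folklore] -/
theorem agree1_iff : ∀ (m : Fin 4) (j₁ j₂ : Fin 16),
    agree1 m j₁ j₂ = true ↔ j₁ = fsetb m (fbit m j₁) j₂ := by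
  decide +kernel

/-- [folklore] -/
theorem agree1_iff' : ∀ (m : Fin 4) (j j' : Fin 16),
    agree1 m j j' = true ↔ j' = fsetb m (fbit m j') j := by
  decide +kernel

/-- [folklore] -/
theorem agree2_iff : ∀ (m m' : Fin 4) (j₁ j₂ : Fin 16), m ≠ m' →
    (agree2 m m' j₁ j₂ = true ↔ j₁ = fsetb m (fbit m j₁) (fsetb m' (fbit m' j₁) j₂)) := by
  decide +kernel

/-- [folklore] -/
theorem fbit_fsetb_fsetb : ∀ (m m' : Fin 4) (a c : Fin 2) (j : Fin 16), m ≠ m' →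
    fbit m (fsetb m a (fsetb m' c j)) = a ∧ fbit m' (fsetb m a (fsetb m' c j)) = c := by
  decide +kernel

/-- [folklore] -/
theorem fbit_xcode : ∀ (i : Fin 2) (j₁ j₁' : Fin 16),
    fbit 0 (xcode i j₁ j₁') = fbit (fpos0 i) j₁ ∧ fbit 1 (xcode i j₁ j₁') = fbit (fpos0 i) j₁' ∧
    fbit 2 (xcode i j₁ j₁') = fbit (fpos1 i) j₁ ∧ fbit 3 (xcode i j₁ j₁') = fbit (fpos1 i) j₁' := by
  decide +kernel

/-- [folklore] -/
theorem fbit_codeOf : ∀ (i : Fin 2) (j₂ j₂' : Fin 16),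
    fbit 0 (codeOf i j₂ j₂') = fbit (rpos0 i) j₂ ∧ fbit 1 (codeOf i j₂ j₂') = fbit (rpos1 i) j₂ ∧
    fbit 2 (codeOf i j₂ j₂') = fbit (rpos0 i) j₂' ∧ fbit 3 (codeOf i j₂ j₂') = fbit (rpos1 i) j₂' := by
  decide +kernel

/-- [folklore] -/
theorem codeOf_eq_iff (i : Fin 2) (j₂ j₂' c : Fin 16) :
    codeOf i j₂ j₂' = c ↔ code1 i j₂ = clo c ∧ code1 i j₂' = chi c := by
  simp only [codeOf, clo, chi, Fin.ext_iff]
  omega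

/-- [folklore] -/
theorem pflip_ne : ∀ (i : Fin 2) (m : Fin 4), pflip i m ≠ m := by decide

/-! ### Sparse sums against local operator entries -/

/-- Reindex an indicator sum along an injective parametrisation of its support. [folklore] -/
theorem sum_ite_reindex {ι κ : Type*} [Fintype ι] [Fintype κ] [DecidableEq ι] (P : ι → Prop)
    [DecidablePred P] (e : κ → ι) (hinj : Function.Injective e) (hP : ∀ j, P j ↔ ∃ a, e a = j)
    (F : ι → ℤ) : (∑ j, if P j then F j else 0) = ∑ a, F (e a) := by
  rw [← sum_filter]
  have hs : (univ : Finset ι).filter P = (univ : Finset κ).image e := by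
    ext j; simp [hP]
  rw [hs, sum_image fun a _ a' _ h => hinj h]

/-- Only the two configurations agreeing with `j₂` off `m` contribute (first index). [folklore] -/
theorem sum_mul_osI (m : Fin 4) (s : Fin 2 → Fin 2 → ℤ) (j₂ : Fin 16) (g : Fin 16 → ℤ) :
    (∑ j₁ : Fin 16, g j₁ * osI m s j₁ j₂) = ∑ a : Fin 2, g (fsetb m a j₂) * s a (fbit m j₂) := by
  simp only [osI, mul_ite, mul_zero]
  rw [sum_ite_reindex (fun j₁ => agree1 m j₁ j₂ = true) (fun a => fsetb m a j₂)
    (fun a a' h => by simpa [fbit_fsetb_self] using congrArg (fbit m) h)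
    (fun j₁ => by
      rw [agree1_iff]
      exact ⟨fun h => ⟨fbit m j₁, h.symm⟩, fun ⟨a, ha⟩ => by rw [← ha, fbit_fsetb_self]⟩)]
  simp [fbit_fsetb_self]

/-- Only the two configurations agreeing with `j` off `m` contribute (second index). [folklore] -/
theorem sum_osI_mul (m : Fin 4) (s : Fin 2 → Fin 2 → ℤ) (j : Fin 16) (g : Fin 16 → ℤ) :
    (∑ j' : Fin 16, osI m s j j' * g j') = ∑ a' : Fin 2, s (fbit m j) a' * g (fsetb m a' j) := by
  simp only [osI, ite_mul, zero_mul]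
  rw [sum_ite_reindex (fun j' => agree1 m j j' = true) (fun a' => fsetb m a' j)
    (fun a a' h => by simpa [fbit_fsetb_self] using congrArg (fbit m) h)
    (fun j' => by
      rw [agree1_iff']
      exact ⟨fun h => ⟨fbit m j', h.symm⟩, fun ⟨a, ha⟩ => by rw [← ha, fbit_fsetb_self]⟩)]
  simp [fbit_fsetb_self]

/-- Two-site version of `sum_mul_osI`. [folklore] -/
theorem sum_mul_os2I (m m' : Fin 4) (hm : m ≠ m') (s s' : Fin 2 → Fin 2 → ℤ) (j₂ : Fin 16)
    (g : Fin 16 → ℤ) : (∑ j₁ : Fin 16, g j₁ * os2I m s m' s' j₁ j₂) =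
      ∑ a : Fin 2, ∑ c : Fin 2, g (fsetb m a (fsetb m' c j₂)) * (s a (fbit m j₂) * s' c (fbit m' j₂)) := by
  simp only [os2I, mul_ite, mul_zero]
  rw [sum_ite_reindex (fun j₁ => agree2 m m' j₁ j₂ = true) (fun p : Fin 2 × Fin 2 => fsetb m p.1 (fsetb m' p.2 j₂))
    (fun p p' h => by
      have h1 := congrArg (fbit m) h
      have h2 := congrArg (fbit m') h
      simp only [(fbit_fsetb_fsetb m m' _ _ j₂ hm).1, (fbit_fsetb_fsetb m m' _ _ j₂ hm).2] at h1 h2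
      exact Prod.ext h1 h2)
    (fun j₁ => by
      rw [agree2_iff m m' j₁ j₂ hm]
      exact ⟨fun h => ⟨(fbit m j₁, fbit m' j₁), h.symm⟩, fun ⟨p, hp⟩ => by
        rw [← hp, (fbit_fsetb_fsetb m m' _ _ j₂ hm).1, (fbit_fsetb_fsetb m m' _ _ j₂ hm).2]⟩)]
  rw [Fintype.sum_prod_type]
  refine sum_congr rfl fun a _ => sum_congr rfl fun c _ => ?_
  rw [(fbit_fsetb_fsetb m m' a c j₂ hm).1, (fbit_fsetb_fsetb m m' a c j₂ hm).2]

/-- [folklore] -/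
theorem XIdir_eq_XI (m : Fin 4) (s : Fin 2 → Fin 2 → ℤ) (j j' : Fin 16) :
    XIdir m s j j' = XI m s j j' := by
  unfold XIdir XI
  exact sum_congr rfl fun j₂ _ => by rw [sum_mul_osI]

/-- [folklore] -/
theorem XBIdir_eq_XBI (m m' : Fin 4) (hm : m ≠ m') (s s' : Fin 2 → Fin 2 → ℤ) (j j' : Fin 16) :
    XBIdir m s m' s' j j' = XBI m s m' s' j j' := by
  unfold XBIdir XBI
  exact sum_congr rfl fun j₂ _ => by rw [sum_mul_os2I m m' hm]

/-- [folklore] -/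
theorem DIdir_eq_DIdef (m : Fin 4) (a a' : Fin 2) (m' : Fin 4) (c c' : Fin 2) :
    DIdir m a a' m' c c' = DIdef m a a' m' c c' := by
  unfold DIdir DIdef
  refine sum_congr rfl fun j _ => ?_
  simp only [sum_osI_mul]

/-! ### Factorisation of the corner product and the hoisting identity -/

/-- Table of the position codes `pbit`/`pflip`/`fpos`/`rpos` (hoisting identity). [folklore] -/
private theorem tabs :
    (pbit 0 0 = 0 ∧ pbit 0 1 = 1 ∧ pbit 0 2 = 0 ∧ pbit 0 3 = 1 ∧ pflip 0 0 = 1 ∧ pflip 0 2 = 3 ∧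
      fpos0 0 = 0 ∧ fpos1 0 = 2 ∧ rpos0 0 = 1 ∧ rpos1 0 = 3) ∧
    (pbit 1 0 = 0 ∧ pbit 1 1 = 0 ∧ pbit 1 2 = 1 ∧ pbit 1 3 = 1 ∧ pflip 1 0 = 2 ∧ pflip 1 1 = 3 ∧
      fpos0 1 = 0 ∧ fpos1 1 = 1 ∧ rpos0 1 = 2 ∧ rpos1 1 = 3) := by
  decide

/-- The corner product factorises through the two codes. [folklore] -/
theorem P1I_eq (i : Fin 2) (j₁ j₁' j₂ j₂' : Fin 16) :
    P1I i j₁ j₁' j₂ j₂' = SS i j₁ j₁' * Dfac i (xcode i j₁ j₁') (codeOf i j₂ j₂') := by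
  obtain ⟨hx0, hx1, hx2, hx3⟩ := fbit_xcode i j₁ j₁'
  obtain ⟨hc0, hc1, hc2, hc3⟩ := fbit_codeOf i j₂ j₂'
  simp only [Dfac, SS, hx0, hx1, hx2, hx3, hc0, hc1, hc2, hc3, P1I, Fin.prod_univ_four]
  have h10 : (1 : Fin 2) ≠ 0 := by decide
  match i with
  | 0 =>
    obtain ⟨⟨h1, h2, h3, h4, h5, h6, h7, h8, h9, h10'⟩, -⟩ := tabs
    simp only [h1, h2, h3, h4, h5, h6, h7, h8, h9, h10', if_true, h10, if_false]
    ring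
  | 1 =>
    obtain ⟨-, ⟨h1, h2, h3, h4, h5, h6, h7, h8, h9, h10'⟩⟩ := tabs
    simp only [h1, h2, h3, h4, h5, h6, h7, h8, h9, h10', if_true, h10, if_false]
    ring

/-- The inner plaquette-pair sum against a code-dependent factor is the weighted code sum. [folklore] -/
theorem sum_codeOf_eq (i : Fin 2) (m : Fin 4) (t : Fin 3) (x : Fin 16) :
    (∑ j₂ : Fin 16, ∑ j₂' : Fin 16,
        XI (pflip i m) (spin2 t) j₂ j₂' * P2I i j₂ j₂' * Dfac i x (codeOf i j₂ j₂')) =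
      ∑ c : Fin 16, W2def i m t c * Dfac i x c := by
  -- insert the indicator `∑ c, [codeOf = c]`, exchange the sums, split the indicator
  have key : ∀ j₂ j₂' : Fin 16,
      XI (pflip i m) (spin2 t) j₂ j₂' * P2I i j₂ j₂' * Dfac i x (codeOf i j₂ j₂') =
        ∑ c : Fin 16, if codeOf i j₂ j₂' = c then
          XI (pflip i m) (spin2 t) j₂ j₂' * P2I i j₂ j₂' * Dfac i x c else 0 := by
    intro j₂ j₂'
    rw [sum_ite_eq]; simp
  have L1 : ∀ c : Fin 16, W2def i m t c * Dfac i x c =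
      ∑ j₂ : Fin 16, ∑ j₂' : Fin 16, if codeOf i j₂ j₂' = c then
        XI (pflip i m) (spin2 t) j₂ j₂' * P2I i j₂ j₂' * Dfac i x c else 0 := by
    intro c
    unfold W2def
    rw [sum_mul]
    refine sum_congr rfl fun j₂ _ => ?_
    simp_rw [codeOf_eq_iff]
    split_ifs with hA
    · rw [sum_mul]
      refine sum_congr rfl fun j₂' _ => ?_
      simp only [hA, true_and]
      split_ifs <;> simp
    · simp [hA]
  simp_rw [key, L1]
  conv_rhs => rw [sum_comm]
  refine sum_congr rfl fun j₂ _ => ?_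
  conv_rhs => rw [sum_comm]

/-- Exchange of a quadruple sum (pairs `(a,b)` with pairs `(c,d)`). [folklore] -/
theorem sum_comm_pairs {α : Type*} [Fintype α] (G : α → α → α → α → ℤ) :
    (∑ a, ∑ b, ∑ c, ∑ d, G a b c d) = ∑ c, ∑ d, ∑ a, ∑ b, G a b c d := by
  calc (∑ a, ∑ b, ∑ c, ∑ d, G a b c d)
      = ∑ p : α × α, ∑ q : α × α, G p.1 p.2 q.1 q.2 := by simp only [Fintype.sum_prod_type]
    _ = ∑ q : α × α, ∑ p : α × α, G p.1 p.2 q.1 q.2 := sum_comm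
    _ = _ := by simp only [Fintype.sum_prod_type]

/-- **Hoisting identity.** Given kernel checks of the two 16-entry tables, the direct quadruple
A-sum equals the hoisted double sum. [folklore] -/
theorem IAdir_eq_IAfast (i : Fin 2) (m : Fin 4) (t : Fin 3) (W T : Fin 16 → ℤ)
    (hW : ∀ c, W2def i m t c = W c) (hT : ∀ x, Tdef i W x = T x) :
    IAdir i m t = IAfast i m t T := by
  have hTx : ∀ x, T x = ∑ j₂ : Fin 16, ∑ j₂' : Fin 16,
      XI (pflip i m) (spin2 t) j₂ j₂' * P2I i j₂ j₂' * Dfac i x (codeOf i j₂ j₂') := by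
    intro x
    rw [sum_codeOf_eq, ← hT]
    exact sum_congr rfl fun c _ => by rw [hW]
  have body : ∀ j₁ j₁' j₂ j₂' : Fin 16,
      XI (pflip i m) (spin2 t) j₂ j₂' * (XI m (spin1 t) j₁ j₁' * (P1I i j₁ j₁' j₂ j₂' * P2I i j₂ j₂')) =
        XI m (spin1 t) j₁ j₁' * (SS i j₁ j₁' *
          (XI (pflip i m) (spin2 t) j₂ j₂' * P2I i j₂ j₂' * Dfac i (xcode i j₁ j₁') (codeOf i j₂ j₂'))) := by
    intro j₁ j₁' j₂ j₂'
    rw [P1I_eq]; ring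
  unfold IAdir IAfast
  simp_rw [body, hTx, mul_sum]
  exact sum_comm_pairs fun j₂ j₂' j₁ j₁' => XI m (spin1 t) j₁ j₁' * (SS i j₁ j₁' *
    (XI (pflip i m) (spin2 t) j₂ j₂' * P2I i j₂ j₂' * Dfac i (xcode i j₁ j₁') (codeOf i j₂ j₂')))

end Summit.HubbardSuperconductivity.HubbardLadder.Bounds
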